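import Summits.HodgeConjecture.HodgeConjecture.Theses.DeltaPeriodAudit
import Literature.NumberTheory.EllipticCurves.SchollBettiRealisation
import Literature.NumberTheory.EllipticCurves.NewformGaloisRep
import Literature.NumberTheory.EllipticCurves.NewformsRealCoefficients
import Literature.NumberTheory.EllipticCurves.PeriodRationalityProofs

/-!
# Birth skeleton (BC3) of the crux `HodgeForcesNewformPeriodRatioIrrational`
# (stmt-HodgeConjecture-2365), route `DeltaPeriodAudit` — line `birth`:
# "Scholl's motive is Galois-rigid, so under HC its Hodge line has irrational slope"

The crux: `HodgeConjecture →` for every newform `f ∈ S_k(Γ₀(N))`, `k ≥ 3`, with rational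
coefficients (`coeffField f = ⊥`) and without complex multiplication, and all critical indices
`a, b ≤ k - 2` of opposite parity with `s_a(f) s_b(f) ≠ 0`
(`s_j(f) = ∫₀^∞ tʲ Re f(it) dt = Λ(f, j+1)`), the number `(s_a(f)/s_b(f))²` is irrational.

The line cuts Deligne's chain (route header, Lemma 2 + Lemma 1) at its two natural joints, over the
tree's hypothesis structure `SchollBettiRealisation f` (Scholl's Betti realisation
`V_f = Π_f H^{k-1}(W(ℂ); ℚ)` of the motive of `f`, with `F_∞`, the Eichler–Shimura class `ω_f` and
the RATIONAL period functionals `φ_j`, `φ_j(ω_f) = r_j(f) = i^{j+1} s_j(f)`, `φ_j ∘ F_∞ = (-1)ʲ φ_j`)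
and the tree's Galois-representation vocabulary (`FramedGaloisRep ℚ ℚ_[ℓ] 2`,
`IsGaloisRepOfNewform1`):

* STUB A (THE HEART; Scholl 1990 + Deligne 1982, conditional on HC only where HC is used) —
  **Scholl's motive as a Betti–`ℓ`-adic system obeying Deligne's principle**: every rational newform
  `f` of weight `k ≥ 3` on `Γ₀(N)` has a Scholl datum `D` and, for every prime `ℓ`, a continuous
  `ρ : Γ_ℚ → GL₂(ℚ_ℓ)` attached to `f` and a framing `θ : ℚ_ℓ ⊗ V_f ≃ ℚ_ℓ²` (Artin comparison of
  `Π_f H^{k-1}_B` with `Π_f H^{k-1}_ét`, Scholl Thm. 1.2.4) such that, IF the Hodge conjecture holds,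
  every endomorphism of Hodge structures of `H^{k-1}(W(ℂ); ℚ)` compressed to `V_f` commutes with
  `ρ(g)` for all `g` in an open subgroup of `Γ_ℚ` (HC on the components of `(W × W)_ℂ` makes the
  Künneth class of the endomorphism algebraic; algebraic classes are defined over `ℚ̄`, i.e. over a
  number field, and cycle classes are Galois-compatible under Artin's comparison —
  Deligne 1982, 2.1(a) + 2.9(b); tree: `Motives.AlgebraicClassesArePotentiallyTate`).
* STUB B (Ribet 1985 / Momose 1981, PROVED in the tree as `momose_isOpen_range_galoisRep_holds`, plus
  linear algebra; M–L) — **open image ⟹ rational scalar commutant**: for `f` rational, non-CM, and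
  `ρ` attached to `f`, a `ℚ`-endomorphism `B` of a `ℚ`-form `V` of `ℚ_ℓ²` whose transport commutes
  with `ρ(g)` for `g` in an open subgroup is a rational scalar (`ρ(U)` is open in `GL₂(ℚ_ℓ)`, so it
  contains `1 + ℓⁿ M₂(ℤ_ℓ)`, whose commutant is `ℚ_ℓ`; and `B ⊗ 1 = c ⊗ 1` forces `c = tr B / 2 ∈ ℚ`).
* STUB C (Eichler–Shimura–Manin dictionary = route Lemma 1 on `V_f`; M–L, provable now from the
  fields of `SchollBettiRealisation`) — **no extra Hodge endomorphisms ⟹ irrational period ratio**: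
  if every Hodge endomorphism compressed to `V_f` is a rational scalar then `(s_a/s_b)² ∉ ℚ` for
  every opposite-parity pair with `s_a s_b ≠ 0` (contrapositive: `φ_a|V_f`, `φ_b|V_f` are a dual
  `F_∞`-eigenbasis, `ω_f ∝ τ e_a + e_b` with `τ = i^{a-b} s_a/s_b`, `τ² = -(s_a/s_b)²`; if this is
  rational, `B = (0 τ²; 1 0)` is a rational non-scalar endomorphism of `V_f` fixing the Hodge line
  `ℂ ω_f = F^{k-1} ∩ V_f,ℂ = F¹ ∩ V_f,ℂ`, hence `ι ∘ B ∘ Π_f` is a Hodge endomorphism with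
  non-scalar compression — the support item `EigenlineCMCriterion` of the route).

`HodgeForcesNewformPeriodRatioIrrational_of` is the kernel-checked composition
STUB A → STUB B → STUB C → the crux BY NAME (no `sorry`): given HC and `f, a, b` as in the crux,
STUB A gives `D, ρ₂, θ₂` and Galois-equivariance of every compressed Hodge endomorphism, STUB B
(at `ℓ = 2`) makes each of them a rational scalar, and STUB C (with `f` real on the imaginary axis,
PROVED: `IsNewform0.cuspCoeff_im_eq_zero` + `im_apply_ofComplex_mul_I_eq_zero`) concludes.

Junk analysis (why the cut is at `∃ D` and not `∀ D`): `SchollBettiRealisation f` is a hypothesis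
structure whose `hodge` field is an ABSTRACT Hodge structure on the real `H^{k-1}(W(ℂ); ℚ)`; the
Hodge conjecture constrains only the geometric one, so "HC → ∀ D, End_HS(V_f(D)) = ℚ" would not be
a consequence of Deligne's chain for junk `D` (for `k = 4`, `L(f, 2) = 0` a junk datum with CM
`V_f` is consistent with every field of the structure). STUB A therefore asks for ONE datum with
its `ℓ`-adic package (existential, junk-free); STUBS B and C are stated for ALL data and are true
for all of them (pure algebra on the fields).

Disproof used: none on file (`Cruxes/HodgeForcesNewformPeriodRatioIrrational/` had no
`Disproof.lean`, no ideas, no lines at registration, 2026-08-17); negatives index of the summit: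
3 unrelated refutations.
-/

noncomputable section

namespace Summit.HodgeConjecture.HodgeConjecture.Cruxes.HodgeForcesNewformPeriodRatioIrrational.Birth

open scoped TensorProduct
open Literature.AlgebraicGeometry.Motives
open Literature.NumberTheory.EllipticCurves.ModularForms
open Literature.NumberTheory.GaloisRepresentations
open Summit.HodgeConjecture.HodgeConjecture.Theses.DeltaPeriodAudit
  (HodgeForcesNewformPeriodRatioIrrational)

/-! ### Vocabulary of the line (definitions over existing declarations) -/

section Vocabulary

variable {Γ : Subgroup (GL (Fin 2) ℝ)} {k : ℤ} {f : CuspForm Γ k}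

/-- The **compression** to `V_f = Π_f H^{k-1}(W(ℂ); ℚ)` of a `ℚ`-endomorphism `A` of
`H^{k-1}(W(ℂ); ℚ)`: `x ↦ Π_f (A x)` on `V_f` (equal to `Π_f A Π_f` there, as `Π_f = 1` on `V_f`).
For `A` an endomorphism of Hodge structures this is the induced endomorphism of the sub-Hodge
structure `V_f` (Deninger–Scholl 1991, 5.2 Remark (2)). [cite: DeningerScholl1991, Thm. 5.2 and Remark (2)] -/
def compress (D : SchollBettiRealisation f)
    (A : bettiCohomology D.W (k - 1).toNat →ₗ[ℚ] bettiCohomology D.W (k - 1).toNat) :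
    D.carrier →ₗ[ℚ] D.carrier :=
  (D.proj.toLinearMap ∘ₗ A).restrict fun x _ => LinearMap.mem_range_self D.proj.toLinearMap (A x)

/-- Unfolding lemma for `compress`. [folklore] -/
@[simp]
theorem compress_apply_coe (D : SchollBettiRealisation f)
    (A : bettiCohomology D.W (k - 1).toNat →ₗ[ℚ] bettiCohomology D.W (k - 1).toNat)
    (x : D.carrier) : (compress D A x : bettiCohomology D.W (k - 1).toNat) = D.proj.toLinearMap (A x) :=
  rfl

end Vocabulary

section Galois

variable {ℓ : ℕ} [Fact ℓ.Prime]

/-- The **transport** of a `ℚ`-endomorphism `B` of a `ℚ`-vector space `V` to `ℚ_ℓ²` along a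
framing `θ : ℚ_ℓ ⊗_ℚ V ≃ ℚ_ℓ²` (intended: Artin's comparison isomorphism
`V_f ⊗ ℚ_ℓ ≅ Π_f H^{k-1}_ét(W_ℚ̄, ℚ_ℓ)` followed by a basis): `θ ∘ (B ⊗ 1) ∘ θ⁻¹`. [folklore] -/
def transport {V : Type*} [AddCommGroup V] [Module ℚ V]
    (θ : ℚ_[ℓ] ⊗[ℚ] V ≃ₗ[ℚ_[ℓ]] (Fin 2 → ℚ_[ℓ])) (B : V →ₗ[ℚ] V) :
    (Fin 2 → ℚ_[ℓ]) →ₗ[ℚ_[ℓ]] (Fin 2 → ℚ_[ℓ]) :=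
  θ.toLinearMap ∘ₗ B.baseChange ℚ_[ℓ] ∘ₗ θ.symm.toLinearMap

/-- **Galois-equivariance on an open subgroup**: the `ℚ_ℓ`-linear endomorphism `T` of `ℚ_ℓ²`
commutes with `ρ(g)` for every `g` in some open subgroup `U ≤ Γ_ℚ = Gal(ℚ̄/ℚ)` (Krull topology)
— Deligne's "`Gal(k/k₀)` acts on `Cᵖ_AH(X)` through a finite quotient" for the class of `T`
(Deligne 1982, Prop. 2.9(b)); Tate's "fixed by an open subgroup" (Tate 1994, §1).
[cite: Deligne1982HodgeCycles, Prop. 2.9(b)] -/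
def GaloisEquivariantOnOpen (ρ : FramedGaloisRep ℚ ℚ_[ℓ] 2)
    (T : (Fin 2 → ℚ_[ℓ]) →ₗ[ℚ_[ℓ]] (Fin 2 → ℚ_[ℓ])) : Prop :=
  ∃ U : OpenSubgroup (Field.absoluteGaloisGroup ℚ), ∀ g ∈ U,
    FramedRep.toRepresentation ρ g ∘ₗ T = T ∘ₗ FramedRep.toRepresentation ρ g

end Galois

/-! ### The three registered stubs -/

/-- STUB A (THE HEART; XL) — **Scholl's motive of a rational newform as a Betti–`ℓ`-adic system
obeying Deligne's principle under the Hodge conjecture.** For every newform `f ∈ S_k(Γ₀(N))`,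
`k ≥ 3`, with `K_f = ℚ` there is a Scholl Betti datum `D` (Scholl 1990, Thm. 1.2.4;
Deninger–Scholl 1991, Thm. 5.2: `W = X̄̄_nʷ` over `ℚ`, `Π_f`, `ω_f`, Shokurov's period functionals)
such that for every prime `ℓ` there are a continuous representation `ρ : Γ_ℚ → GL₂(ℚ_ℓ)` attached
to `f` away from `N ℓ` (`IsGaloisRepOfNewform1 (liftToGamma1 N k f)`: unramified with
`charpoly ρ(Frob_p) = X² − a_p X + p^{k−1}` — Deligne 1969 / Scholl Thm. 1.2.4 (ii):
`Π_f H^{k-1}_ét = V_ℓ(f)`) and a framing `θ : ℚ_ℓ ⊗ V_f ≃ ℚ_ℓ²` (Artin's comparison isomorphism on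
`W`, compatible with `Π_f`) with DELIGNE'S PRINCIPLE: if the Hodge conjecture holds, then for every
endomorphism `A` of the Hodge structure `H^{k-1}(W(ℂ); ℚ)` the transport of its compression to
`V_f` commutes with `ρ(g)` for `g` in an open subgroup of `Γ_ℚ` — because the Künneth–Poincaré
class of `Π_f A Π_f` in `H^{2k-2}((W × W)(ℂ); ℚ)(k-1)` is a Hodge class, HC (applied to the
geometrically irreducible components of `(W × W)_ℂ`, smooth projective of dimension `2k - 2`)
makes it algebraic, algebraic cycles on `(W × W)_ℂ` are homologous to cycles defined over a number
field `K'`, and Artin's comparison carries their classes to `Gal(ℚ̄/K')`-invariant classes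
(Deligne 1982, Ex. 2.1(a), Prop. 2.9(b); tree: `Motives.AlgebraicClassesArePotentiallyTate`,
`AlgebraicClassesArePotentiallyTate.hodgeClassesArePotentiallyTate`). This is where — and the only
place where — the Hodge conjecture is consumed. Why it might fail: it does not on paper; in the
tree it needs the Kuga–Sato variety as a scheme (`nonempty_kugaSatoVariety`), the Eichler–Shimura
comparison (S4) and Shokurov cycles (S5) of `SchollBettiRealisation`'s docstring, étale cohomology
of `W` with Artin comparison, and the identification of the sub-problem's `HodgeConjectureFor`
Hodge classes with those of `D.hodge ⊗ D.hodge` via Künneth — five unbuilt theories.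
[cite: Scholl1990, §1.2 Thm. 1.2.4] [cite: DeningerScholl1991, Thm. 5.2, 5.3]
[cite: Deligne1982HodgeCycles, Ex. 2.1(a), Prop. 2.9(b)] [cite: Deligne1971Bourbaki355] -/
theorem stub_schollMotive_of_hodgeConjecture :
    ∀ (N : ℕ) [NeZero N] (k : ℤ) (f : CuspForm (CongruenceSubgroup.Gamma0 N) k),
      3 ≤ k → IsNewform0 f → coeffField f = ⊥ →
      ∃ D : SchollBettiRealisation f,
        ∀ (ℓ : ℕ) [Fact ℓ.Prime],
          ∃ (ι : coeffCharField (liftToGamma1 N k f) →+* ℚ_[ℓ])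
            (ρ : FramedGaloisRep ℚ ℚ_[ℓ] 2)
            (θ : ℚ_[ℓ] ⊗[ℚ] D.carrier ≃ₗ[ℚ_[ℓ]] (Fin 2 → ℚ_[ℓ])),
            IsGaloisRepOfNewform1 (liftToGamma1 N k f) ι {p | p ∣ N * ℓ} ρ ∧
            (_root_.HodgeConjecture →
              ∀ A : HodgeStructure.Hom D.hodge D.hodge,
                GaloisEquivariantOnOpen ρ (transport θ (compress D A.toLinearMap))) := by
  sorry

/-- STUB B (Ribet 1985 / Momose 1981 + linear algebra; M–L, provable now) — **open image ⟹ rational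
scalar commutant.** Let `f ∈ S_k(Γ₀(N))`, `k ≥ 2`, be a newform with `K_f = ℚ` and without
complex multiplication (no Dirichlet character `η ≠ 1` with `η(p) a_p = a_p` for almost all
primes `p`), `ℓ` a prime and `ρ : Γ_ℚ → GL₂(ℚ_ℓ)` attached to `f` away from `N ℓ`. If a
`ℚ`-endomorphism `B` of a `ℚ`-vector space `V` with a framing `θ : ℚ_ℓ ⊗ V ≃ ℚ_ℓ²` has transport
`θ (B ⊗ 1) θ⁻¹` commuting with `ρ(g)` for all `g` in an open subgroup `U ≤ Γ_ℚ`, then `B` is a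
RATIONAL scalar. Proof in print: `f` lifts to a newform on `Γ₁(N)` with trivial nebentypus and
`coeffCharField = ℚ` (tree: `isNewform1_liftToGamma1_iff_holds`, `nebentypus_liftToGamma1_holds`,
`coe_liftToGamma1_holds`, `IsNewform0.heckeEigenvalue_eq_coeff_holds` to match the non-CM clauses);
by the open-image theorem (tree, PROVED: `momose_isOpen_range_galoisRep_holds`) `ρ(Γ_ℚ)` is open in
`GL₂(ℚ_ℓ)`, and `ρ(U)` (closed of finite index in it) is open too, so it contains
`1 + ℓⁿ M₂(ℤ_ℓ)` for some `n`; an endomorphism commuting with `1 + ℓⁿ E_{ij}` for all `i, j` is a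
scalar `c ∈ ℚ_ℓ`; finally `B ⊗ 1 = c • 1` on `ℚ_ℓ ⊗ V` with `V ≠ 0` a `ℚ`-form forces
`c = tr(B)/2 ∈ ℚ` and `B = c • id` (`ℚ → ℚ_ℓ` injective, `ℚ_ℓ ⊗_ℚ –` faithful). Why it might fail:
only by a slip between the two non-CM clauses (`heckeEigenvalue f p` here, `(qExpansion 1 f).coeff p`
in the fact) at the finitely many primes `p ∣ N` — both clauses are "for almost all `p`", so none.
[cite: Ribet1985, §3 p. 191 (Momose's theorem) and Introduction (1)] [cite: Momose1981]
[cite: SerreAbelianLadic1968, Ch. IV] -/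
theorem stub_rationalScalar_of_galoisCommutant :
    ∀ (N : ℕ) [NeZero N] (k : ℤ) (f : CuspForm (CongruenceSubgroup.Gamma0 N) k),
      2 ≤ k → IsNewform0 f → coeffField f = ⊥ →
      (¬ ∃ (M : ℕ) (η : DirichletCharacter ℂ M), η ≠ 1 ∧
          ∀ᶠ p : ℕ in Filter.cofinite, p.Prime →
            η (p : ZMod M) * heckeEigenvalue f p = heckeEigenvalue f p) →
      ∀ (ℓ : ℕ) [Fact ℓ.Prime] (ι : coeffCharField (liftToGamma1 N k f) →+* ℚ_[ℓ])
        (ρ : FramedGaloisRep ℚ ℚ_[ℓ] 2),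
        IsGaloisRepOfNewform1 (liftToGamma1 N k f) ι {p | p ∣ N * ℓ} ρ →
        ∀ (V : Type) [AddCommGroup V] [Module ℚ V]
          (θ : ℚ_[ℓ] ⊗[ℚ] V ≃ₗ[ℚ_[ℓ]] (Fin 2 → ℚ_[ℓ])) (B : V →ₗ[ℚ] V),
          GaloisEquivariantOnOpen ρ (transport θ B) → ∃ c : ℚ, B = c • LinearMap.id := by
  sorry

/-- STUB C (the period dictionary, route Lemma 1 on `V_f`; M–L, provable now from the fields of
`SchollBettiRealisation`) — **no extra Hodge endomorphisms on `V_f` ⟹ the cross-parity period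
ratio squared is irrational.** Let `f ∈ S_k(Γ₀(N))` be real on the imaginary axis with
`K_f = ℚ`, `D` a Scholl Betti datum of `f` (so `V_f = Π_f H^{k-1}(W(ℂ); ℚ)` has rank `2`,
`F¹ ∩ V_f,ℂ = F^{k-1} ∩ V_f,ℂ = ℂ ω_f`, and for `j + 2 ≤ k` there is a rational functional `φ_j`
with `φ_j(ω_f) = r_j(f) = i^{j+1} s_j(f)`, `φ_j ∘ F_∞ = (-1)ʲ φ_j`). If every endomorphism of the
Hodge structure `D.hodge` has compression to `V_f` a rational scalar, then for all `a, b ≤ k - 2`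
of opposite parity with `s_a(f) s_b(f) ≠ 0`, `(s_a(f)/s_b(f))²` is irrational. Contrapositive
(Paşol–Popa 2013, Prop. 5.11 / Manin 1973 for the rationality packaged in `D.period`; the matrix
is the route's support item `EigenlineCMCriterion`): `φ_a|V_f ≠ 0 ≠ φ_b|V_f` (they do not kill
`ω_f ∈ V_f,ℂ`) are `F_∞^*`-eigenvectors of opposite signs, hence a basis of `V_f^*`; in the dual
basis `ω_f = i^{a+1}s_a e_a + i^{b+1}s_b e_b ∝ τ e_a + e_b`, `τ² = -(s_a/s_b)²`; if
`(s_a/s_b)² = q ∈ ℚ`, the rational matrix `B = (0 -q; 1 0)` (`B e_a = e_b`, `B e_b = -q e_a`)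
satisfies `B ω_f = τ ω_f`, so `ι ∘ B ∘ Π_f` preserves every `F^p` (`F^p ∩ V_f,ℂ ∈ {V_f,ℂ, ℂω_f, 0}`
by `F_zero`, `F_one_inf_eq`, `finrank_F_inf_range`, `F_weight_add_one`) — a Hodge endomorphism
whose compression `B` is not a scalar. Why it might fail: only through the normalisation
`r_j = i^{j+1} s_j` (`imagAxisPeriod_eq_of_im_eq_zero`, proved) — a sign slip changes `τ²` by a
sign, which does not affect rationality. [cite: PasolPopa2013, Prop. 5.11 and Cor. 5.12]
[cite: Manin1973, Thm. 1.3] [cite: Deligne1982HodgeCycles, §3 (CM Hodge structures)] -/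
theorem stub_periodRatioSq_irrational_of_hodgeEndScalar :
    ∀ (N : ℕ) [NeZero N] (k : ℤ) (f : CuspForm (CongruenceSubgroup.Gamma0 N) k)
      (D : SchollBettiRealisation f),
      coeffField f = ⊥ →
      (∀ t : ℝ, 0 < t → (f (UpperHalfPlane.ofComplex ((t : ℂ) * Complex.I))).im = 0) →
      (∀ A : HodgeStructure.Hom D.hodge D.hodge, ∃ c : ℚ, compress D A.toLinearMap = c • LinearMap.id) →
      ∀ a b : ℕ, (a : ℤ) + 2 ≤ k → (b : ℤ) + 2 ≤ k → Odd (a + b) →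
        (∫ t in Set.Ioi (0:ℝ), t ^ a * (f (UpperHalfPlane.ofComplex ((t : ℂ) * Complex.I))).re) ≠ 0 →
        (∫ t in Set.Ioi (0:ℝ), t ^ b * (f (UpperHalfPlane.ofComplex ((t : ℂ) * Complex.I))).re) ≠ 0 →
        Irrational (((∫ t in Set.Ioi (0:ℝ), t ^ a * (f (UpperHalfPlane.ofComplex ((t : ℂ) * Complex.I))).re) /
          (∫ t in Set.Ioi (0:ℝ), t ^ b * (f (UpperHalfPlane.ofComplex ((t : ℂ) * Complex.I))).re)) ^ 2) := by
  sorry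

/-! ### The composition: STUB A → STUB B → STUB C → the crux, by name -/

/-- **A newform on `Γ₀(N)` is real on the imaginary axis** (PROVED glue): its Fourier coefficients
are real (`IsNewform0.cuspCoeff_im_eq_zero`, Shimura 1971, proof of Thm. 3.48), so
`f(it) = ∑ aₙ e^{-2πnt} ∈ ℝ` (`im_apply_ofComplex_mul_I_eq_zero`). [cite: Shimura1971, proof of Thm. 3.48] -/
theorem im_apply_imagAxis_eq_zero_of_isNewform0 {N : ℕ} [NeZero N] {k : ℤ}
    {f : CuspForm (CongruenceSubgroup.Gamma0 N) k} (hf : IsNewform0 f) :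
    ∀ t : ℝ, 0 < t → (f (UpperHalfPlane.ofComplex ((t : ℂ) * Complex.I))).im = 0 :=
  fun _ ht => im_apply_ofComplex_mul_I_eq_zero f (fun n => hf.cuspCoeff_im_eq_zero n) ht

/-- **THE LINE'S COMPOSITION** (kernel-checked, no `sorry`): STUB A → STUB B → STUB C →
`HodgeForcesNewformPeriodRatioIrrational`. Given HC and `f, a, b` as in the crux: STUB A supplies
Scholl's datum `D` with, at `ℓ = 2`, a representation `ρ` attached to `f`, a framing `θ`, and the
Galois-equivariance (on an open subgroup) of every compressed Hodge endomorphism; STUB B turns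
each of these into a rational scalar; STUB C, with `f` real on the imaginary axis
(`im_apply_imagAxis_eq_zero_of_isNewform0`), yields the irrationality of `(s_a/s_b)²`. [folklore] -/
theorem HodgeForcesNewformPeriodRatioIrrational_of :
    (∀ (N : ℕ) [NeZero N] (k : ℤ) (f : CuspForm (CongruenceSubgroup.Gamma0 N) k),
      3 ≤ k → IsNewform0 f → coeffField f = ⊥ →
      ∃ D : SchollBettiRealisation f,
        ∀ (ℓ : ℕ) [Fact ℓ.Prime],
          ∃ (ι : coeffCharField (liftToGamma1 N k f) →+* ℚ_[ℓ])
            (ρ : FramedGaloisRep ℚ ℚ_[ℓ] 2)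
            (θ : ℚ_[ℓ] ⊗[ℚ] D.carrier ≃ₗ[ℚ_[ℓ]] (Fin 2 → ℚ_[ℓ])),
            IsGaloisRepOfNewform1 (liftToGamma1 N k f) ι {p | p ∣ N * ℓ} ρ ∧
            (_root_.HodgeConjecture →
              ∀ A : HodgeStructure.Hom D.hodge D.hodge,
                GaloisEquivariantOnOpen ρ (transport θ (compress D A.toLinearMap)))) →
    (∀ (N : ℕ) [NeZero N] (k : ℤ) (f : CuspForm (CongruenceSubgroup.Gamma0 N) k),
      2 ≤ k → IsNewform0 f → coeffField f = ⊥ →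
      (¬ ∃ (M : ℕ) (η : DirichletCharacter ℂ M), η ≠ 1 ∧
          ∀ᶠ p : ℕ in Filter.cofinite, p.Prime →
            η (p : ZMod M) * heckeEigenvalue f p = heckeEigenvalue f p) →
      ∀ (ℓ : ℕ) [Fact ℓ.Prime] (ι : coeffCharField (liftToGamma1 N k f) →+* ℚ_[ℓ])
        (ρ : FramedGaloisRep ℚ ℚ_[ℓ] 2),
        IsGaloisRepOfNewform1 (liftToGamma1 N k f) ι {p | p ∣ N * ℓ} ρ →
        ∀ (V : Type) [AddCommGroup V] [Module ℚ V]
          (θ : ℚ_[ℓ] ⊗[ℚ] V ≃ₗ[ℚ_[ℓ]] (Fin 2 → ℚ_[ℓ])) (B : V →ₗ[ℚ] V),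
          GaloisEquivariantOnOpen ρ (transport θ B) → ∃ c : ℚ, B = c • LinearMap.id) →
    (∀ (N : ℕ) [NeZero N] (k : ℤ) (f : CuspForm (CongruenceSubgroup.Gamma0 N) k)
      (D : SchollBettiRealisation f),
      coeffField f = ⊥ →
      (∀ t : ℝ, 0 < t → (f (UpperHalfPlane.ofComplex ((t : ℂ) * Complex.I))).im = 0) →
      (∀ A : HodgeStructure.Hom D.hodge D.hodge, ∃ c : ℚ, compress D A.toLinearMap = c • LinearMap.id) →
      ∀ a b : ℕ, (a : ℤ) + 2 ≤ k → (b : ℤ) + 2 ≤ k → Odd (a + b) →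
        (∫ t in Set.Ioi (0:ℝ), t ^ a * (f (UpperHalfPlane.ofComplex ((t : ℂ) * Complex.I))).re) ≠ 0 →
        (∫ t in Set.Ioi (0:ℝ), t ^ b * (f (UpperHalfPlane.ofComplex ((t : ℂ) * Complex.I))).re) ≠ 0 →
        Irrational (((∫ t in Set.Ioi (0:ℝ), t ^ a * (f (UpperHalfPlane.ofComplex ((t : ℂ) * Complex.I))).re) /
          (∫ t in Set.Ioi (0:ℝ), t ^ b * (f (UpperHalfPlane.ofComplex ((t : ℂ) * Complex.I))).re)) ^ 2)) →
    HodgeForcesNewformPeriodRatioIrrational := by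
  intro hA hB hC hHC N _ k f hk hf hQ hCM a b ha hb hab hsa hsb
  obtain ⟨D, hD⟩ := hA N k f hk hf hQ
  refine hC N k f D hQ (im_apply_imagAxis_eq_zero_of_isNewform0 hf) ?_ a b ha hb hab hsa hsb
  intro A
  haveI : Fact (Nat.Prime 2) := ⟨Nat.prime_two⟩
  obtain ⟨ι, ρ, θ, hρ, hgal⟩ := hD 2
  exact hB N k f (by omega) hf hQ hCM 2 ι ρ hρ D.carrier θ (compress D A.toLinearMap) (hgal hHC A)

/-- **The crux, closed modulo exactly the three registered stubs.** -/
theorem HodgeForcesNewformPeriodRatioIrrational_of_stubs : HodgeForcesNewformPeriodRatioIrrational :=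
  HodgeForcesNewformPeriodRatioIrrational_of stub_schollMotive_of_hodgeConjecture
    stub_rationalScalar_of_galoisCommutant stub_periodRatioSq_irrational_of_hodgeEndScalar

end Summit.HodgeConjecture.HodgeConjecture.Cruxes.HodgeForcesNewformPeriodRatioIrrational.Birth

end
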